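import Literature.AlgebraicGeometry.Frobenioids.UnitTrivializationFrobeniusCompact
import Literature.AlgebraicGeometry.Frobenioids.DivisorMonoidBirationalProp48iii
import HarnessLib

/-!
# Frobenioids I, Proposition 4.8 (iii) at THE data of Definition 4.5 (iii)

Mochizuki, *The geometry of Frobenioids I: the general theory*, Kyushu J. Math. **62** (2008)
293–400, Prop. 4.8 (iii) p. 88: "If `C` is of rationally standard type, then `(C^istr)^birat` is of
standard type." [cite: MochizukiFrdI2008, Prop. 4.8 (iii) p.88]
Proof-only capstone (3 lines) combining seat abc-iut-L6-t20's `prop48iii_of_frobeniusCompact` (all of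
Prop. 4.8 (iii) but the Frobenius-compact object of `(C^istr)^birat`) with seat abc-iut-L1-d5's
`exists_isFrobeniusCompact_istrBirat_of_rationallyStandard` (that object, from Def. 4.5 (iii)(b) read at
THE birationalization of `C^un-tr`): Prop. 4.8 (iii) for the §3–§4 data of a Frobenioid `F` whose
Def. 4.5 (iii) parameters are THE birationalization of `C`, a support notion `Supp`, THE operations of
`C^un-tr` and THE birationalization of `C^un-tr` — CONDITIONAL only on Prop. 4.4 (ii) for `C^istr`
(`hB`, «`(C^istr)^birat → F_{0_D}` is a Frobenioid», used for the commutativity of `O^×`).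
No statement of the paper is strengthened; nothing here bears on [IUTchIII] Cor. 3.12.
-/

namespace Literature.AlgebraicGeometry.Frobenioids

open CategoryTheory Opposite

universe w v v' u u'

namespace PreFrobenioidData

variable {D : Type u} [Category.{v} D] {Φ : Dᵒᵖ ⥤ CommMonCat.{w}}
  {C : Type u'} [Category.{v'} C] {F : C ⥤ ElemFrobenioid Φ}

/-- **[FrdI] Prop. 4.8 (iii) at THE data**: if `C → F_Φ` is of rationally standard type with respect to
THE parameters `(C^birat, Supp, C^un-tr, (C^un-tr)^birat)`, then `(C^istr)^birat → F_{0_D}` is of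
standard type — conditional on Prop. 4.4 (ii) for `C^istr` (`hB`). [cite: MochizukiFrdI2008, Prop. 4.8 (iii) p.88] -/
theorem prop48iii_rationallyStandard (hF : PreFrobenioid.IsFrobenioid F)
    (hsq : PreFrobenioid.HasBiratSquares F)
    (hsq' : PreFrobenioid.HasBiratSquares (PreFrobenioid.istrFunctor F))
    (Supp : ∀ {X : D}, (ofFunctor Φ F).Mon X → Primes ((ofFunctor Φ F).Mon X) → Prop)
    (hR : (ofFunctor Φ F).IsOfRationallyStandardType
      ⟨PreFrobenioid.biratData hF hsq, Supp, ofFunctor Φ (PreFrobenioid.untrFunctor hF),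
        PreFrobenioid.biratData (PreFrobenioid.isFrobenioid_untr hF) (PreFrobenioid.hasBiratSquares_untr hF)⟩)
    (hB : PreFrobenioid.IsFrobenioid
      (PreFrobenioid.Birat.toElemZero (PreFrobenioid.isFrobenioid_istr hF) hsq')) :
    (ofFunctor (zeroMonoid D)
      (PreFrobenioid.Birat.toElemZero (PreFrobenioid.isFrobenioid_istr hF) hsq')).IsOfStandardType :=
  prop48iii_of_frobeniusCompact hF hsq hsq' Supp _ _ hR
    (PreFrobenioid.Birat.exists_isFrobeniusCompact_istrBirat_of_rationallyStandard hF hsq' hsq Supp hR hB)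

end PreFrobenioidData

end Literature.AlgebraicGeometry.Frobenioids
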